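import Literature.MathematicalPhysics.QuantumFieldTheory.Balaban1983to89.B12Membership313IILie

/-!
# `Balaban1983to89.LogChartBCHClosure` — the Lie algebra of EVERY log-charted matrix group is closed under the
Baker–Campbell–Hausdorff composition `log(e^X e^Y)` on the WHOLE convergence range `‖X‖ + ‖Y‖ < log 2`; for T. Bałaban,
*Renormalization group approach to lattice gauge field theories. I*, Commun. Math. Phys. **109** (1987) 249–301
[Balaban1987RG1], (1.13) p. 262: the clause «A′ has values in the algebra 𝐠ᶜ» for the product configuration at the
lineage's radius `ξ(|A| + |A′|) ≤ 1/4`, for EVERY complex `𝐠ᶜ`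

HONEST FRAMING (cell `lit-balaban`, verbatim): statement-level skeleton of published theorems with citation tags; proofs where
landed; nothing here is a claim about the Yang–Mills mass gap.

CITATION HEADER (lean-in-tree rule).  Cell `lit-balaban`, unit `lit-balaban-r20` (reader/typer r20 gen 16: B12 fold owner and
DEFINITIONS steward; TAKING line HOME/STATUS.md 2026-08-22T05:3xZ, file 1 of 2 — file 2 `B12RegularSpaces111ClosedSubgroup` uses it
to discharge the `𝐠ᶜ`-closure hypothesis `hgcN` of the concrete regular spaces for every closed `G ≤ U(N)`), HOME
`run/shared/lean/pub/lit-balaban/`.  Source held: `paper:balaban1987-cmp109-rg-i-small-field` (journal page = PDF page + 248),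
p. 262 [PDF 14] (1.13), p. 252 [PDF 4], read from the text layer.

THE PRINT, verbatim.  p. 262 (1.13): *«(ii) U′ = exp iξA′, A′ has values in the algebra 𝐠ᶜ, |A′|, |∇^ξ_U A′| < α₁ on X.»*; p. 252:
*«𝐔 = U′U, where U ∈ G and U′ = exp iA′, A′ ∈ 𝐠ᶜ, 𝐠ᶜ is the complexification of the real Lie algebra 𝐠.»*  The composition of two
`U′`-factors `e^{iξA}e^{iξA′} = e^{iξA″}`, `A″ = (iξ)⁻¹log(e^{iξA}e^{iξA′})` (`B12Membership313II.newPot`), must again be `𝐠ᶜ`-valued —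
the BCH series lies in the Lie algebra.

WHAT IS PROVED (kernel-checked; `𝔸` any complete normed `ℂ`-algebra, `log` = the tree's series `MatrixLog.mlog`).
* **`bchLog_mem_lie_of_lt`**: for a log-charted group `Gc : LogChart 𝔸` (`BlockAveragingFederbushGValued.LogChart`: `exp 𝔤 ⊆ G`,
  `log(G ∩ B̄_ρ(1)) ⊆ 𝔤`) whose Lie algebra `𝔤` is closed (automatic in finite dimension, `bchLog_mem_lie_of_lt'`), and `X, Y ∈ 𝔤` with
  `‖X‖ + ‖Y‖ < log 2`: `log(e^X e^Y) ∈ 𝔤`.  The tree's `B12Membership313IILie.bchLog_mem_lie` needs `e^X e^Y` inside the G-DEPENDENT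
  chart radius `ρ` (e.g. `min(1/3, 3/N)` for `SL(N, ℂ)`); here the real-analytic path `s ↦ log(e^{sX}e^{sY})` (analytic while
  `|s|(‖X‖ + ‖Y‖) < log 2`: Mathlib's `exp_analytic`, `AnalyticAt.mul`, the tree's `MatrixLog.analyticAt_mlog`, scalars restricted to `ℝ`)
  lies in `𝔤` for small `|s|` by the chart, hence its image in the normed quotient `𝔸 ⧸ 𝔤` vanishes near `0` and therefore, by the
  identity theorem on the interval `{|s|(‖X‖ + ‖Y‖) < log 2} ∋ 1` (Mathlib `AnalyticOnNhd.eqOn_zero_of_preconnected_of_eventuallyEq_zero`),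
  at `s = 1`.
* **`newPot_mem_lie_of_lt`** / **`newPot_mem_lie_of_le_quarter`**: for a COMPLEX closed `𝔤ᶜ` (`i•𝔤ᶜ ⊆ 𝔤ᶜ`), `A, A′ ∈ 𝔤ᶜ` and
  `|ξ|(‖A‖ + ‖A′‖) < log 2` — in particular the lineage's range `0 ≤ ξ`, `ξ(‖A‖ + ‖A′‖) ≤ 1/4` — give `newPot ξ A A′ ∈ 𝔤ᶜ`: the clause of
  (1.13) for `A″` WITHOUT the chart-radius restriction `2α₁ ≤ Gc.ρ` of `B12Membership313IILie.condII_expMul_lie` (reading note (a) there).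

HONEST SCOPE.  Pure Banach-algebra / analytic-continuation plumbing: nothing of [I] is asserted; the Lie-theoretic input is the chart's
`mlog_mem` near `1` (Hall's Cor. 3.44) and the BCH statement proved is Hall's Thm. 5.3 «log(e^X e^Y) ∈ 𝔤» in its qualitative form.
Theorems only (no definition, no `Prop` placeholder, no new fact); axioms standard.  Rows served (cells only, NO head change):
B12.Eq1.11-1.14 / B12.Eq3.28-3.29 (display owner r09, carrier p07), B12.Def§0 (owner r20).
-/

noncomputable section

namespace Literature.MathematicalPhysics.QuantumFieldTheory.Balaban1983to89.LogChartBCHClosure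

open NormedSpace Set Filter Topology
open Literature.MathematicalPhysics.QuantumFieldTheory.Balaban1983to89
open Literature.MathematicalPhysics.QuantumFieldTheory.Balaban1983to89.B12Membership313II (bchLog newPot
  norm_exp_mul_exp_sub_one_le_of_le)
open Literature.MathematicalPhysics.QuantumFieldTheory.Balaban1983to89.B12Membership313IILie (bchLog_eq_mlog bchLog_mem_lie
  smul_mem_lie_of_I_smul_mem norm_expMul_sub_one_le_two_mul)
open Complex (I)

/-! ## BCH closure of the Lie algebra of a log-charted group on the whole convergence range -/

section BCH

variable {𝔸 : Type*} [NormedRing 𝔸] [NormedAlgebra ℂ 𝔸] [CompleteSpace 𝔸]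

omit [CompleteSpace 𝔸] in
/-- The path `s ↦ log(e^{sX} e^{sY})` at `s` is the lineage's `bchLog (sX) (sY)`. [folklore] -/
private theorem bchPath_eq_bchLog (X Y : 𝔸) (s : ℝ) :
    MatrixLog.mlog (exp ((s : ℂ) • X) * exp ((s : ℂ) • Y)) = bchLog (s • X) (s • Y) := by
  rw [bchLog_eq_mlog, Complex.coe_smul, Complex.coe_smul]

omit [CompleteSpace 𝔸] in
/-- `‖sX‖ + ‖sY‖ = |s|(‖X‖ + ‖Y‖)` for a real parameter. [folklore] -/
private theorem norm_real_smul_add (X Y : 𝔸) (s : ℝ) : ‖(s : ℂ) • X‖ + ‖(s : ℂ) • Y‖ = |s| * (‖X‖ + ‖Y‖) := by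
  rw [norm_smul, norm_smul, Complex.norm_real, Real.norm_eq_abs]; ring

/-- On `|s|(‖X‖ + ‖Y‖) < log 2` the product `e^{sX}e^{sY}` is within `1` of `1` (the logarithmic series converges). [folklore] -/
private theorem norm_expMul_sub_one_lt_one {X Y : 𝔸} {s : ℝ} (hs : |s| * (‖X‖ + ‖Y‖) < Real.log 2) :
    ‖exp ((s : ℂ) • X) * exp ((s : ℂ) • Y) - 1‖ < 1 := by
  have h1 := norm_exp_mul_exp_sub_one_le_of_le (le_of_eq (norm_real_smul_add X Y s))
  have h2 : Real.exp (|s| * (‖X‖ + ‖Y‖)) < 2 := by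
    calc Real.exp (|s| * (‖X‖ + ‖Y‖)) < Real.exp (Real.log 2) := Real.exp_lt_exp.mpr hs
      _ = 2 := Real.exp_log (by norm_num)
  linarith

/-- The path is real-analytic on `|s|(‖X‖ + ‖Y‖) < log 2`: `exp`, the product and the tree's `mlog` are complex-analytic, the
parameter enters through the real line. [folklore] -/
private theorem analyticAt_bchPath {X Y : 𝔸} {s : ℝ} (hs : |s| * (‖X‖ + ‖Y‖) < Real.log 2) :
    AnalyticAt ℝ (fun s : ℝ => MatrixLog.mlog (exp ((s : ℂ) • X) * exp ((s : ℂ) • Y))) s := by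
  -- the complex-parameter map `f z = e^{zX} e^{zY}`
  set f : ℂ → 𝔸 := fun z => exp (z • X) * exp (z • Y) with hf
  have hsmX : AnalyticAt ℂ (fun z : ℂ => z • X) (s : ℂ) := analyticAt_id.smul analyticAt_const
  have hsmY : AnalyticAt ℂ (fun z : ℂ => z • Y) (s : ℂ) := analyticAt_id.smul analyticAt_const
  have hX : AnalyticAt ℂ (fun z : ℂ => exp (z • X)) (s : ℂ) :=
    AnalyticAt.fun_comp (f := fun z : ℂ => z • X) (x := (s : ℂ)) (exp_analytic ((s : ℂ) • X)) hsmX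
  have hY : AnalyticAt ℂ (fun z : ℂ => exp (z • Y)) (s : ℂ) :=
    AnalyticAt.fun_comp (f := fun z : ℂ => z • Y) (x := (s : ℂ)) (exp_analytic ((s : ℂ) • Y)) hsmY
  have hprod : AnalyticAt ℂ f (s : ℂ) := hX.mul hY
  have hlog : AnalyticAt ℂ (MatrixLog.mlog : 𝔸 → 𝔸) (f (s : ℂ)) :=
    MatrixLog.analyticAt_mlog (norm_expMul_sub_one_lt_one hs)
  have hC : AnalyticAt ℂ (MatrixLog.mlog ∘ f) (s : ℂ) := hlog.comp hprod
  have hR : AnalyticAt ℝ (MatrixLog.mlog ∘ f) (Complex.ofRealCLM s) := hC.restrictScalars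
  have hfin : AnalyticAt ℝ ((MatrixLog.mlog ∘ f) ∘ Complex.ofRealCLM) s := hR.comp (Complex.ofRealCLM.analyticAt s)
  exact hfin

omit [NormedAlgebra ℂ 𝔸] [CompleteSpace 𝔸] in
/-- The parameter domain `{s : |s|(‖X‖ + ‖Y‖) < log 2}` is an interval, hence preconnected. [folklore] -/
private theorem isPreconnected_dom (X Y : 𝔸) : IsPreconnected {s : ℝ | |s| * (‖X‖ + ‖Y‖) < Real.log 2} := by
  rw [isPreconnected_iff_ordConnected]
  refine ⟨fun a ha b hb s hs => ?_⟩
  simp only [mem_setOf_eq] at ha hb ⊢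
  have hc : 0 ≤ ‖X‖ + ‖Y‖ := add_nonneg (norm_nonneg _) (norm_nonneg _)
  have hmax : |s| ≤ max |a| |b| := abs_le_max_abs_abs hs.1 hs.2
  rcases le_max_iff.mp hmax with h | h
  · exact lt_of_le_of_lt (mul_le_mul_of_nonneg_right h hc) ha
  · exact lt_of_le_of_lt (mul_le_mul_of_nonneg_right h hc) hb

/-- **BCH CLOSURE OF THE LIE ALGEBRA OF A LOG-CHARTED GROUP ON THE WHOLE CONVERGENCE RANGE.**  For a log-charted group `Gc`
(`LogChart`: `exp 𝔤 ⊆ G`, `log(G ∩ B̄_ρ(1)) ⊆ 𝔤`) whose Lie algebra `𝔤` is closed, and `X, Y ∈ 𝔤` with `‖X‖ + ‖Y‖ < log 2`: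
`log(e^X e^Y) ∈ 𝔤`.  Proof: the real-analytic path `s ↦ log(e^{sX}e^{sY})` lies in `𝔤` for `|s|` small (chart, tree
`bchLog_mem_lie`), hence its image in `𝔸 ⧸ 𝔤` vanishes near `0` and, by the identity theorem on the interval
`|s|(‖X‖ + ‖Y‖) < log 2 ∋ 1`, at `s = 1`.  The tree's `bchLog_mem_lie` is the case `‖e^X e^Y − 1‖ ≤ ρ`.
[cite: Hall2015, Thm. 5.3 (Baker–Campbell–Hausdorff) with Cor. 3.44; Balaban1987RG1, (1.13) p.262 («A′ has values in the algebra 𝐠ᶜ»)] -/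
theorem bchLog_mem_lie_of_lt (Gc : LogChart 𝔸) (hK : IsClosed (Gc.lie : Set 𝔸)) {X Y : 𝔸} (hX : X ∈ Gc.lie)
    (hY : Y ∈ Gc.lie) (h : ‖X‖ + ‖Y‖ < Real.log 2) : bchLog X Y ∈ Gc.lie := by
  set K := Gc.lie with hKdef
  haveI : IsClosed (K : Set 𝔸) := hK
  set c := ‖X‖ + ‖Y‖ with hc
  have hc0 : 0 ≤ c := add_nonneg (norm_nonneg _) (norm_nonneg _)
  -- the quotient map as a continuous real-linear map, and the quotient path
  let πL : 𝔸 →L[ℝ] (𝔸 ⧸ K) := LinearMap.mkContinuous K.mkQ 1 fun m => by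
    rw [one_mul]; exact Submodule.Quotient.norm_mk_le K m
  have hπL : ∀ m, πL m = K.mkQ m := fun _ => rfl
  set F : ℝ → 𝔸 := fun s => MatrixLog.mlog (exp ((s : ℂ) • X) * exp ((s : ℂ) • Y)) with hF
  set g : ℝ → 𝔸 ⧸ K := fun s => πL (F s) with hg
  set U : Set ℝ := {s : ℝ | |s| * c < Real.log 2} with hU
  have hlog2 : (0 : ℝ) < Real.log 2 := Real.log_pos (by norm_num)
  have h0U : (0 : ℝ) ∈ U := by simp [hU, hlog2]
  have h1U : (1 : ℝ) ∈ U := by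
    show |(1 : ℝ)| * c < Real.log 2
    rw [abs_one, one_mul]; exact h
  -- analyticity of the quotient path on `U`
  have hgan : AnalyticOnNhd ℝ g U := fun s hs =>
    (πL.analyticAt _).comp (analyticAt_bchPath (by simpa [hU, hc] using hs))
  -- the path lies in `K` near `0`
  set s₀ : ℝ := min 1 (Gc.ρ / 2) / (c + 1) with hs₀
  have hs₀pos : 0 < s₀ := div_pos (lt_min one_pos (half_pos Gc.ρ_pos)) (by linarith)
  have hsmall : ∀ s : ℝ, |s| < s₀ → F s ∈ K := by
    intro s hs
    have hsc : |s| * c ≤ min 1 (Gc.ρ / 2) := by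
      have h1 : |s| * c ≤ |s| * (c + 1) := mul_le_mul_of_nonneg_left (by linarith) (abs_nonneg s)
      have h2 : |s| * (c + 1) ≤ s₀ * (c + 1) := mul_le_mul_of_nonneg_right hs.le (by linarith)
      have h3 : s₀ * (c + 1) = min 1 (Gc.ρ / 2) := by rw [hs₀]; field_simp
      linarith
    have hXs : (s : ℂ) • X ∈ K := by rw [Complex.coe_smul]; exact K.smul_mem _ hX
    have hYs : (s : ℂ) • Y ∈ K := by rw [Complex.coe_smul]; exact K.smul_mem _ hY
    have hn : ‖(s : ℂ) • X‖ + ‖(s : ℂ) • Y‖ = |s| * c := norm_real_smul_add X Y s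
    have hle1 : ‖(s : ℂ) • X‖ + ‖(s : ℂ) • Y‖ ≤ 1 := by rw [hn]; exact hsc.trans (min_le_left _ _)
    have hρ : ‖exp ((s : ℂ) • X) * exp ((s : ℂ) • Y) - 1‖ ≤ Gc.ρ := by
      calc ‖exp ((s : ℂ) • X) * exp ((s : ℂ) • Y) - 1‖ ≤ 2 * (‖(s : ℂ) • X‖ + ‖(s : ℂ) • Y‖) :=
            norm_expMul_sub_one_le_two_mul hle1
        _ = 2 * (|s| * c) := by rw [hn]
        _ ≤ 2 * (Gc.ρ / 2) := by gcongr; exact hsc.trans (min_le_right _ _)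
        _ = Gc.ρ := by ring
    have := bchLog_mem_lie Gc hXs hYs hρ
    rwa [bchLog_eq_mlog] at this
  have hg0 : g =ᶠ[𝓝 (0 : ℝ)] 0 := by
    filter_upwards [Metric.ball_mem_nhds (0 : ℝ) hs₀pos] with s hs
    rw [Metric.mem_ball, dist_zero_right, Real.norm_eq_abs] at hs
    show πL (F s) = 0
    rw [hπL, Submodule.mkQ_apply, Submodule.Quotient.mk_eq_zero]
    exact hsmall s hs
  -- identity theorem
  have hzero := hgan.eqOn_zero_of_preconnected_of_eventuallyEq_zero (isPreconnected_dom X Y) h0U hg0 h1U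
  have h1 : πL (F 1) = 0 := hzero
  rw [hπL, Submodule.mkQ_apply, Submodule.Quotient.mk_eq_zero, hF] at h1
  have h1' : MatrixLog.mlog (exp (((1 : ℝ) : ℂ) • X) * exp (((1 : ℝ) : ℂ) • Y)) ∈ K := h1
  rwa [bchPath_eq_bchLog, one_smul, one_smul] at h1'

/-- Finite-dimensional form (the Lie algebra is then automatically closed). [cite: Hall2015, Thm. 5.3, Cor. 3.44] -/
theorem bchLog_mem_lie_of_lt' [FiniteDimensional ℂ 𝔸] (Gc : LogChart 𝔸) {X Y : 𝔸} (hX : X ∈ Gc.lie) (hY : Y ∈ Gc.lie)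
    (h : ‖X‖ + ‖Y‖ < Real.log 2) : bchLog X Y ∈ Gc.lie := by
  haveI : FiniteDimensional ℝ 𝔸 := FiniteDimensional.complexToReal 𝔸
  exact bchLog_mem_lie_of_lt Gc (Submodule.closed_of_finiteDimensional _) hX hY h

/-- **`A″ = newPot ξ A A′ = (iξ)⁻¹ log(e^{iξA} e^{iξA′}) ∈ 𝔤ᶜ` for `A, A′ ∈ 𝔤ᶜ` (complex `𝔤ᶜ`, closed) whenever `|ξ|(‖A‖ + ‖A′‖) < log 2`**
— the clause «A′ has values in the algebra 𝐠ᶜ» of (1.13) for the product configuration, on the whole range of the BCH series; the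
lineage's range `ξ(‖A‖ + ‖A′‖) ≤ 1/4` is inside (`newPot_mem_lie_of_le_quarter`). [cite: Balaban1987RG1, (1.13) p.262] -/
theorem newPot_mem_lie_of_lt (Gc : LogChart 𝔸) (hK : IsClosed (Gc.lie : Set 𝔸))
    (hI : ∀ ⦃X : 𝔸⦄, X ∈ Gc.lie → (I : ℂ) • X ∈ Gc.lie) {ξ : ℝ} {A A' : 𝔸} (hA : A ∈ Gc.lie) (hA' : A' ∈ Gc.lie)
    (h : |ξ| * (‖A‖ + ‖A'‖) < Real.log 2) : newPot ξ A A' ∈ Gc.lie := by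
  unfold newPot
  refine smul_mem_lie_of_I_smul_mem Gc hI _ (bchLog_mem_lie_of_lt Gc hK (smul_mem_lie_of_I_smul_mem Gc hI _ hA)
    (smul_mem_lie_of_I_smul_mem Gc hI _ hA') ?_)
  have e : ‖(I * ξ : ℂ) • A‖ + ‖(I * ξ : ℂ) • A'‖ = |ξ| * (‖A‖ + ‖A'‖) := by
    rw [norm_smul, norm_smul, norm_mul, Complex.norm_I, one_mul, Complex.norm_real, Real.norm_eq_abs]; ring
  rwa [e]

/-- The lineage's range: `0 ≤ ξ`, `ξ(‖A‖ + ‖A′‖) ≤ 1/4 ⟹ newPot ξ A A′ ∈ 𝔤ᶜ` (since `1/4 < log 2`). [cite: Balaban1987RG1, (1.13) p.262] -/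
theorem newPot_mem_lie_of_le_quarter (Gc : LogChart 𝔸) (hK : IsClosed (Gc.lie : Set 𝔸))
    (hI : ∀ ⦃X : 𝔸⦄, X ∈ Gc.lie → (I : ℂ) • X ∈ Gc.lie) {ξ : ℝ} (hξ : 0 ≤ ξ) {A A' : 𝔸} (hA : A ∈ Gc.lie)
    (hA' : A' ∈ Gc.lie) (h : ξ * (‖A‖ + ‖A'‖) ≤ 1 / 4) : newPot ξ A A' ∈ Gc.lie := by
  refine newPot_mem_lie_of_lt Gc hK hI hA hA' ?_
  rw [abs_of_nonneg hξ]
  have := Real.log_two_gt_d9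
  linarith

end BCH

end Literature.MathematicalPhysics.QuantumFieldTheory.Balaban1983to89.LogChartBCHClosure

end
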